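import Literature.AlgebraicTopology.Homotopy.SequenceTelescope
import HarnessLib

/-!
# Mapping telescopes of sequences: canonical representatives, height, and Hausdorffness

Topic `Literature/AlgebraicTopology/Homotopy` (sub-namespace `SeqTelescope`), continuing
`SequenceTelescope.lean` (the abstract mapping telescope `SeqTelescope f` of a sequence
`X₀ → X₁ → ⋯`, Hatcher, *Algebraic Topology* (2002), §3.F, p. 312). Point-set facts about the
quotient needed to put a CW structure on it (`SequenceTelescopeCW.lean`; Hatcher, proof of
Prop. A.11, p. 528: "`T(f, f, …)` … is a CW complex"), all PROVED:

* `SeqTelescope.crep`: canonical representatives (parameter in `[0, 1)`), a section of the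
  quotient map; equality criteria `SeqTelescope.mk_eq_mk_iff`, `mk_eq_mk_iff_of_lt_one(')`,
  `mk_zero_eq_mk_zero_iff`.
* `SeqTelescope.height : C(T(f), ℝ)`, `(n, x, t) ↦ n + t`.
* `SeqTelescope.continuousOn_of_comp_mk`: continuity on an OPEN subset of the telescope is
  checked cylinder by cylinder.
* `SeqTelescope.levelCoord n x₀`: the level-`n` coordinate, continuous on the open slab of
  heights `(n - ½, n + 1)` (`continuousOn_levelCoord`), recovering `x` from `(n, x, t)`, `t < 1`.
* `SeqTelescope.instT2Space`: **the mapping telescope of a sequence of Hausdorff spaces is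
  Hausdorff** (different heights are separated by `height`, equal heights by `levelCoord`).

No separation or CW hypotheses beyond `T2Space (X n)` for the last item; no `sorry`;
[folklore] throughout.

## References

* A. Hatcher, *Algebraic Topology*, CUP (2002), §3.F p. 312 (mapping telescope); Appendix,
  proof of Prop. A.11 (p. 528). [HatcherAT2002]
-/

noncomputable section

open Set Topology unitInterval Function
open scoped ContinuousMap

universe u v w

namespace Literature.AlgebraicTopology.Homotopy

namespace SeqTelescope

variable {X : ℕ → Type u} [∀ n, TopologicalSpace (X n)] (f : ∀ n, C(X n, X (n + 1)))

/-! ### Canonical representatives -/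

/-- The canonical representative of `(n, x, t)`: itself if `t < 1`, else `(n + 1, fₙ x, 0)`.
[folklore] -/
def crepAux (n : ℕ) (x : X n) (t : I) : Σ n, X n × I :=
  if (t : ℝ) < 1 then ⟨n, (x, t)⟩ else ⟨n + 1, (f n x, 0)⟩

/-- `crepAux` respects the gluing. [folklore] -/
theorem crepAux_one_eq (n : ℕ) (x : X n) : crepAux f n x 1 = crepAux f (n + 1) (f n x) 0 := by
  simp [crepAux]

/-- **Canonical representatives**: the section `T(f) → Σ n, Xₙ × [0, 1)` of the quotient map
picking the representative with parameter `< 1`. [folklore] -/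
def crep : SeqTelescope f → Σ n, X n × I :=
  Quot.lift (fun p => crepAux f p.1 p.2.1 p.2.2) (by rintro _ _ ⟨n, x⟩; exact crepAux_one_eq f n x)

/-- `crep` on points. [folklore] -/
theorem crep_mk (n : ℕ) (x : X n) (t : I) : crep f (mk f n x t) = crepAux f n x t := rfl

/-- `crep` of a point with parameter `< 1`. [folklore] -/
theorem crep_mk_of_lt_one {n : ℕ} {x : X n} {t : I} (ht : (t : ℝ) < 1) :
    crep f (mk f n x t) = ⟨n, (x, t)⟩ := by
  rw [crep_mk, crepAux, if_pos ht]

/-- `crep` is a section of the quotient map. [folklore] -/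
theorem proj_crep (z : SeqTelescope f) : proj f (crep f z) = z := by
  induction z using ind with
  | h n x t =>
    rw [crep_mk, crepAux]
    split_ifs with h
    · rfl
    · have ht : t = 1 := Subtype.ext (le_antisymm t.2.2 (not_lt.1 h))
      rw [ht, proj_apply, mk_one]

/-- `crep` is injective: points of the telescope are equal iff their canonical representatives
are. [folklore] -/
theorem crep_injective : Injective (crep f) :=
  (LeftInverse.injective fun z => proj_crep f z)

/-- **Equality in the telescope** is equality of canonical representatives. [folklore] -/
theorem mk_eq_mk_iff (n : ℕ) (x : X n) (t : I) (n' : ℕ) (x' : X n') (t' : I) :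
    mk f n x t = mk f n' x' t' ↔ crepAux f n x t = crepAux f n' x' t' :=
  ⟨fun h => by rw [← crep_mk, ← crep_mk, h], fun h => crep_injective f (by rwa [crep_mk, crep_mk])⟩

/-- Two points with parameters `< 1` are equal iff their levels, base points and parameters
agree. [folklore] -/
theorem mk_eq_mk_iff_of_lt_one {n : ℕ} {x : X n} {t : I} {n' : ℕ} {x' : X n'} {t' : I}
    (ht : (t : ℝ) < 1) (ht' : (t' : ℝ) < 1) :
    mk f n x t = mk f n' x' t' ↔ (⟨n, (x, t)⟩ : Σ n, X n × I) = ⟨n', (x', t')⟩ := by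
  rw [mk_eq_mk_iff, crepAux, crepAux, if_pos ht, if_pos ht']

/-- On one level, points with parameters `< 1` are equal iff base points and parameters agree.
[folklore] -/
theorem mk_eq_mk_iff_of_lt_one' {n : ℕ} {x x' : X n} {t t' : I} (ht : (t : ℝ) < 1)
    (ht' : (t' : ℝ) < 1) : mk f n x t = mk f n x' t' ↔ x = x' ∧ t = t' := by
  rw [mk_eq_mk_iff_of_lt_one f ht ht']
  constructor
  · intro h
    simp only [Sigma.mk.injEq, heq_eq_eq, Prod.mk.injEq, true_and] at h
    exact h
  · rintro ⟨rfl, rfl⟩; rfl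

/-- The bottoms `(n, x, 0)` of one level are equal iff the base points are. [folklore] -/
theorem mk_zero_eq_mk_zero_iff {n : ℕ} {x x' : X n} : mk f n x 0 = mk f n x' 0 ↔ x = x' := by
  rw [mk_eq_mk_iff_of_lt_one' f (by norm_num) (by norm_num)]
  simp

/-! ### The height function -/

/-- The **height** `(n, x, t) ↦ n + t`, a continuous real function on the telescope.
[folklore] -/
def height : C(SeqTelescope f, ℝ) :=
  desc f (fun n _ t => (n : ℝ) + t) (fun _ => by fun_prop) fun n x => by push_cast; simp

/-- `height` on points. [folklore] -/
@[simp]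
theorem height_mk (n : ℕ) (x : X n) (t : I) : height f (mk f n x t) = n + t := rfl

/-- Points of equal height with parameters `< 1` have equal level and parameter. [folklore] -/
theorem eq_of_height_eq {n n' : ℕ} {t t' : I} (ht : (t : ℝ) < 1) (ht' : (t' : ℝ) < 1)
    (h : (n : ℝ) + t = n' + t') : n = n' ∧ t = t' := by
  have h0 := t.2.1
  have h0' := t'.2.1
  have hn : n = n' := by
    have h1 : (n : ℝ) < n' + 1 := by linarith
    have h2 : (n' : ℝ) < n + 1 := by linarith
    have h1' : n < n' + 1 := by exact_mod_cast h1
    have h2' : n' < n + 1 := by exact_mod_cast h2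
    omega
  subst hn
  exact ⟨rfl, Subtype.ext (by linarith)⟩

/-! ### Continuity on open subsets of the telescope -/

/-- **Continuity on an open subset of the telescope is checked on the cylinders**: a function
`g` on `T(f)` is continuous on an open `S` as soon as each `g ∘ qₙ`, `qₙ (x, t) = (n, x, t)`, is
continuous on `qₙ⁻¹(S)`. [folklore] -/
theorem continuousOn_of_comp_mk {Z : Type v} [TopologicalSpace Z] {g : SeqTelescope f → Z}
    {S : Set (SeqTelescope f)} (hS : IsOpen S)
    (hg : ∀ n, ContinuousOn (fun p : X n × I => g (mk f n p.1 p.2))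
      ((fun p : X n × I => mk f n p.1 p.2) ⁻¹' S)) :
    ContinuousOn g S := by
  rw [continuousOn_open_iff hS]
  intro W hW
  have hpre : ∀ n, IsOpen ((fun p : X n × I => mk f n p.1 p.2) ⁻¹' (S ∩ g ⁻¹' W)) := fun n =>
    (hg n).isOpen_inter_preimage (hS.preimage (continuous_mk f n)) hW
  rw [← (isQuotientMap_proj f).isOpen_preimage, isOpen_sigma_iff]
  intro n
  exact hpre n

/-! ### Hausdorffness -/

section T2

/-- The level-`n` coordinate near level `n`: on the `n`-th cylinder `(y, s) ↦ y` (for `s < 1`),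
on the `(n-1)`-st cylinder `(y, s) ↦ f y` (for `s > ½`), junk `x₀` elsewhere. [folklore] -/
def levelCoordAux (n : ℕ) (x₀ : X n) (p : Σ k, X k × I) : X n :=
  if h : p.1 = n then (if (p.2.2 : ℝ) < 1 then h ▸ p.2.1 else x₀)
  else if h' : p.1 + 1 = n then (if (1 : ℝ) / 2 < p.2.2 then h' ▸ f p.1 p.2.1 else x₀) else x₀

/-- `levelCoordAux` respects the gluing. [folklore] -/
theorem levelCoordAux_glue (n : ℕ) (x₀ : X n) (k : ℕ) (y : X k) :
    levelCoordAux f n x₀ ⟨k, (y, 1)⟩ = levelCoordAux f n x₀ ⟨k + 1, (f k y, 0)⟩ := by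
  unfold levelCoordAux
  by_cases hk : k = n
  · subst hk
    simp
  · by_cases hk1 : k + 1 = n
    · subst hk1
      simp only [dif_pos]
      rw [dif_neg hk]
      norm_num
    · rw [dif_neg hk, dif_neg hk1, dif_neg hk1]
      by_cases hk2 : k + 1 + 1 = n
      · rw [dif_pos hk2]; norm_num
      · rw [dif_neg hk2]

/-- The level-`n` coordinate as a (discontinuous) function on the telescope. [folklore] -/
def levelCoord (n : ℕ) (x₀ : X n) : SeqTelescope f → X n :=
  Quot.lift (levelCoordAux f n x₀) (by rintro _ _ ⟨k, y⟩; exact levelCoordAux_glue f n x₀ k y)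

/-- `levelCoord` on a point of level `n` with parameter `< 1` is its base point. [folklore] -/
theorem levelCoord_mk_of_lt_one (n : ℕ) (x₀ x : X n) {t : I} (ht : (t : ℝ) < 1) :
    levelCoord f n x₀ (mk f n x t) = x := by
  show levelCoordAux f n x₀ ⟨n, (x, t)⟩ = x
  simp [levelCoordAux, ht]

/-- The open slab of heights `(n - ½, n + 1)`. [folklore] -/
def slab (n : ℕ) : Set (SeqTelescope f) := height f ⁻¹' Ioo ((n : ℝ) - 1 / 2) (n + 1)

/-- The slab is open. [folklore] -/
theorem isOpen_slab (n : ℕ) : IsOpen (slab f n) :=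
  isOpen_Ioo.preimage (height f).continuous

/-- A point of level `n` with parameter `< 1` lies in the `n`-th slab. [folklore] -/
theorem mk_mem_slab {n : ℕ} (x : X n) {t : I} (ht : (t : ℝ) < 1) : mk f n x t ∈ slab f n := by
  show (n : ℝ) + t ∈ Ioo ((n : ℝ) - 1 / 2) (n + 1)
  exact ⟨by linarith [t.2.1], by linarith⟩

/-- **The level coordinate is continuous on the slab.** [folklore] -/
theorem continuousOn_levelCoord (n : ℕ) (x₀ : X n) : ContinuousOn (levelCoord f n x₀) (slab f n) := by
  refine continuousOn_of_comp_mk f (isOpen_slab f n) fun k => ?_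
  -- the preimage of the slab in the `k`-th cylinder, and the coordinate there
  by_cases hk : k = n
  · subst hk
    -- `{s < 1}`, coordinate `y`
    have hpre : (fun p : X k × I => mk f k p.1 p.2) ⁻¹' slab f k ⊆ {p | (p.2 : ℝ) < 1} := by
      rintro ⟨y, s⟩ ⟨-, h2⟩
      simpa using h2
    refine (continuous_fst.continuousOn : ContinuousOn (fun p : X k × I => p.1) _).congr
      (fun p hp => ?_) |>.mono hpre
    show levelCoordAux f k x₀ ⟨k, (p.1, p.2)⟩ = p.1
    simp [levelCoordAux, show (p.2 : ℝ) < 1 from hp]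
  · by_cases hk1 : k + 1 = n
    · subst hk1
      have hpre : (fun p : X k × I => mk f k p.1 p.2) ⁻¹' slab f (k + 1) ⊆
          {p | (1 : ℝ) / 2 < p.2} := by
        rintro ⟨y, s⟩ ⟨h1, -⟩
        simp only [mem_setOf_eq]
        push_cast at h1
        simp only [height_mk] at h1
        linarith
      refine (((f k).continuous.comp continuous_fst).continuousOn :
        ContinuousOn (fun p : X k × I => f k p.1) _).congr (fun p hp => ?_) |>.mono hpre
      show levelCoordAux f (k + 1) x₀ ⟨k, (p.1, p.2)⟩ = f k p.1
      have hp' : (1 : ℝ) / 2 < p.2 := hp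
      unfold levelCoordAux
      rw [dif_neg hk, dif_pos rfl, if_pos hp']
    · -- empty preimage
      have hpre : (fun p : X k × I => mk f k p.1 p.2) ⁻¹' slab f n = ∅ := by
        ext ⟨y, s⟩
        simp only [mem_preimage, slab, height_mk, mem_Ioo, mem_empty_iff_false, iff_false,
          not_and, not_lt]
        intro h1
        have hs0 := s.2.1
        have hs1 := s.2.2
        rcases lt_or_gt_of_ne hk with hlt | hgt
        · have : k + 1 < n := lt_of_le_of_ne hlt hk1
          have : (k : ℝ) + 1 + 1 ≤ n := by exact_mod_cast this
          linarith
        · have : (n : ℝ) + 1 ≤ k := by exact_mod_cast hgt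
          linarith
      rw [hpre]
      exact continuousOn_empty _

variable [∀ n, T2Space (X n)]

/-- **The mapping telescope of Hausdorff spaces is Hausdorff**: points of different height are
separated by the height; points of the same height lie in one slab and are separated by the
level coordinate. [folklore] -/
instance instT2Space : T2Space (SeqTelescope f) := by
  rw [t2Space_iff_disjoint_nhds]
  intro z z' hne
  -- canonical representatives
  obtain ⟨⟨n, x, t⟩, rfl⟩ : ∃ p, proj f p = z := proj_surjective f z
  obtain ⟨⟨n', x', t'⟩, rfl⟩ : ∃ p, proj f p = z' := proj_surjective f z'
  -- reduce to parameters `< 1`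
  wlog ht : (t : ℝ) < 1 generalizing n x t
  · have ht1 : t = 1 := Subtype.ext (le_antisymm t.2.2 (not_lt.1 ht))
    subst ht1
    have := this (n + 1) (f n x) 0 (by rwa [proj_apply, ← mk_one]) (by norm_num)
    rwa [proj_apply, ← mk_one] at this
  wlog ht' : (t' : ℝ) < 1 generalizing n' x' t'
  · have ht1 : t' = 1 := Subtype.ext (le_antisymm t'.2.2 (not_lt.1 ht'))
    subst ht1
    have := this (n' + 1) (f n' x') 0 (by rwa [proj_apply (p := ⟨n' + 1, _⟩), ← mk_one])
      (by norm_num)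
    rwa [proj_apply (p := ⟨n' + 1, _⟩), ← mk_one] at this
  simp only [proj_apply] at hne ⊢
  by_cases hh : (n : ℝ) + t = n' + t'
  · obtain ⟨rfl, rfl⟩ := eq_of_height_eq ht ht' hh
    have hxx : x ≠ x' := fun h => hne (by rw [h])
    obtain ⟨U, U', hU, hU', hxU, hxU', hUU⟩ := t2_separation hxx
    have hc := continuousOn_levelCoord f n x
    refine Filter.disjoint_iff.2 ⟨slab f n ∩ levelCoord f n x ⁻¹' U, ?_,
      slab f n ∩ levelCoord f n x ⁻¹' U', ?_, ?_⟩
    · exact (hc.isOpen_inter_preimage (isOpen_slab f n) hU).mem_nhds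
        ⟨mk_mem_slab f x ht, by simp [levelCoord_mk_of_lt_one f n x x ht, hxU]⟩
    · exact (hc.isOpen_inter_preimage (isOpen_slab f n) hU').mem_nhds
        ⟨mk_mem_slab f x' ht, by simp [levelCoord_mk_of_lt_one f n x x' ht, hxU']⟩
    · exact Set.disjoint_left.2 fun w ⟨_, hw⟩ ⟨_, hw'⟩ => Set.disjoint_left.1 hUU hw hw'
  · -- different heights
    have hd : Disjoint (𝓝 (height f (mk f n x t))) (𝓝 (height f (mk f n' x' t'))) := by
      simpa using hh
    exact Filter.disjoint_of_map (f := height f) ((hd.mono (height f).continuous.continuousAt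
      (height f).continuous.continuousAt))

end T2

end SeqTelescope

end Literature.AlgebraicTopology.Homotopy

end
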